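import Summits.ResolutionOfSingularities.ResolutionOfSingularities.Theorems.WildConesCampaignW46ForcedAtomIsolTransfer
import Mathlib.LinearAlgebra.Dimension.Finrank
import HarnessLib

/-!
# [OURS · L1 W4.6, rungs (i)/(ii) — the dictionary, SCHEME HALF, brick 18] The Tjurina NUMBER is intrinsic under
# arbitrary ring automorphisms of `K⟦X⟧` over a perfect field, and does not depend on the presentation
Cell res-hironaka (LADDER-RESOLUTION rung L, D-0089), slot W4.6, seat res-L1-s46-pv-2 (gen 3). Host: route
`WildCones`, crux `ClassicalRegimes` (stmt-ResolutionOfSingularities-16884), `--supports … --as helper`.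

HONEST FRAMING. Everything here is OURS and pure commutative algebra over Mathlib (`Ideal.quotientEquivAlg`,
`Algebra.finrank_eq_of_equiv_equiv`) and this seat's bricks 11/11b/14/15. NOTHING here is a statement of H. Hironaka's
manuscript [Hironaka2017]; no FACT-LIST premise. AI review is weaker than expert review.

## What is proved (upgrading «the Tjurina algebra is FINITE iff» of bricks 11/14 to «has the same DIMENSION»)

* `finrank_tjurina_eq_of_algEquiv` / `finrank_tjurina_rename` / `finrank_tjurina_eq_of_algEquiv_option` — for a
  `κ`-algebra automorphism `θ` and a unit `w`, `dim_κ κ⟦X⟧/T(w·θF) = dim_κ κ⟦X⟧/T(F)` (`Fin m` and `Option (Fin n)`);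
* `finrank_quotient_map_eq` — `dim_κ κ⟦X⟧/((map s) I) = dim_κ κ⟦X⟧/I` for a field automorphism `s` (a SEMILINEAR ring
  isomorphism of the quotients; `Module.finrank_eq_of_equiv_equiv`);
* `finrank_tjurina_eq_of_ringEquiv_option` — over a PERFECT field of characteristic `p`, the same for every RING
  automorphism `θ` (decomposition `θ = θ′ ∘ map s` of brick 14);
* `finrank_tjurina_eq_of_span_eq` — two formal presentations `E₀(f₀) = w·(z^p − ser c₀)`, `E₀′(f₀′) = w′·(z^p − ser c₀′)`
  of the same principal ideal of a local ring have Tjurina algebras of the SAME dimension: the Tjurina number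
  `τ = dim_K K⟦z,u⟧/T(z^p − ser c₀)` is an invariant of the point of the forced-atom regime, not of the chosen
  presentation (as is therefore `μ(c₀) = τ/p`, the bound of the effective rung — the identity `τ = p·μ` is not proved here).

References: bricks 11 (p510761), 11b (p512560), 14 (p517877), 15 (p519274). [folklore]
-/

noncomputable section

-- single-problem summit: the doubled namespace component `ResolutionOfSingularities` is forced
set_option linter.dupNamespace false

open scoped BigOperators Classical
open MvPowerSeries IsLocalRing

namespace Summit.ResolutionOfSingularities.ResolutionOfSingularities.Theorems

namespace CampaignW46.AtomGerm

open Literature.RingTheory.MvPowerSeries (pd)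
open WildCones

variable {κ : Type} [Field κ]

/-! ## `κ`-algebra automorphisms and renamings: linear isomorphisms of Tjurina algebras -/

/-- The Tjurina algebras of `F` and `w·θF` (`θ` a `κ`-algebra automorphism, `w` a unit) have the same dimension.
[folklore] -/
theorem finrank_tjurina_eq_of_algEquiv {m : ℕ} (θ : MvPowerSeries (Fin m) κ ≃ₐ[κ] MvPowerSeries (Fin m) κ)
    (F w : MvPowerSeries (Fin m) κ) (hw : IsUnit w) :
    Module.finrank κ (MvPowerSeries (Fin m) κ ⧸
        (Ideal.span {w * θ F} ⊔ Ideal.span (Set.range fun j : Fin m => pd j (w * θ F)))) =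
      Module.finrank κ (MvPowerSeries (Fin m) κ ⧸
        (Ideal.span {F} ⊔ Ideal.span (Set.range fun i : Fin m => pd i F))) :=
  (Ideal.quotientEquivAlg (Ideal.span {F} ⊔ Ideal.span (Set.range fun i : Fin m => pd i F))
    (Ideal.span {w * θ F} ⊔ Ideal.span (Set.range fun j : Fin m => pd j (w * θ F))) θ
    (tjurina_smul_algEquiv_eq_map θ F w hw)).toLinearEquiv.finrank_eq.symm

/-- Renaming the variables along an equivalence does not change the dimension of the Tjurina algebra. [folklore] -/
theorem finrank_tjurina_rename {σ τ : Type} [Fintype σ] [Fintype τ] (ε : σ ≃ τ) (F : MvPowerSeries σ κ) :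
    Module.finrank κ (MvPowerSeries τ κ ⧸
        (Ideal.span {rename ε F} ⊔ Ideal.span (Set.range fun t : τ => pd t (rename ε F)))) =
      Module.finrank κ (MvPowerSeries σ κ ⧸ (Ideal.span {F} ⊔ Ideal.span (Set.range fun s : σ => pd s F))) :=
  (Ideal.quotientEquivAlg (Ideal.span {F} ⊔ Ideal.span (Set.range fun s : σ => pd s F))
    (Ideal.span {rename ε F} ⊔ Ideal.span (Set.range fun t : τ => pd t (rename ε F))) (renameEquiv κ ε)
    (tjurina_rename_eq_map ε F)).toLinearEquiv.finrank_eq.symm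

/-- The Tjurina numbers of `F` and `w·θF` agree, germ index `Option (Fin n)` of `κ⟦z,u⟧`, `θ` a `κ`-algebra automorphism.
[folklore] -/
theorem finrank_tjurina_eq_of_algEquiv_option {n : ℕ}
    (θ : MvPowerSeries (Option (Fin n)) κ ≃ₐ[κ] MvPowerSeries (Option (Fin n)) κ)
    (F w : MvPowerSeries (Option (Fin n)) κ) (hw : IsUnit w) :
    Module.finrank κ (MvPowerSeries (Option (Fin n)) κ ⧸
        (Ideal.span {w * θ F} ⊔ Ideal.span (Set.range fun j : Option (Fin n) => pd j (w * θ F)))) =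
      Module.finrank κ (MvPowerSeries (Option (Fin n)) κ ⧸
        (Ideal.span {F} ⊔ Ideal.span (Set.range fun i : Option (Fin n) => pd i F))) := by
  set ε : Option (Fin n) ≃ Fin (n + 1) := (finSuccEquiv n).symm with hε
  set ρ : MvPowerSeries (Option (Fin n)) κ ≃ₐ[κ] MvPowerSeries (Fin (n + 1)) κ := renameEquiv κ ε with hρ
  have hρ_apply : ∀ G, ρ G = rename ε G := fun G => rfl
  rw [← finrank_tjurina_rename ε (w * θ F), ← finrank_tjurina_rename ε F]
  have hG : rename ε (w * θ F) = ρ w * (ρ.symm.trans (θ.trans ρ)) (rename ε F) := by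
    rw [← hρ_apply, map_mul]
    congr 1
    rw [AlgEquiv.trans_apply, AlgEquiv.trans_apply, ← hρ_apply F, AlgEquiv.symm_apply_apply]
  rw [hG]
  exact finrank_tjurina_eq_of_algEquiv (ρ.symm.trans (θ.trans ρ)) (rename ε F) (ρ w) (hw.map ρ)

/-! ## Semilinear: `map` along a field automorphism -/

/-- **`dim_κ κ⟦X⟧/(map s)(I) = dim_κ κ⟦X⟧/I`** for a field automorphism `s`: the quotients are isomorphic by a
`s`-SEMILINEAR ring isomorphism (`Algebra.finrank_eq_of_equiv_equiv`). [folklore] -/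
theorem finrank_quotient_map_eq {σ : Type} (s : κ ≃+* κ) (I : Ideal (MvPowerSeries σ κ)) :
    Module.finrank κ (MvPowerSeries σ κ ⧸ I.map (map (σ := σ) (s : κ →+* κ))) =
      Module.finrank κ (MvPowerSeries σ κ ⧸ I) := by
  let e : MvPowerSeries σ κ ≃+* MvPowerSeries σ κ := RingEquiv.ofBijective (map (σ := σ) (s : κ →+* κ)) (map_bijective s)
  have he : (e : MvPowerSeries σ κ →+* MvPowerSeries σ κ) = map (σ := σ) (s : κ →+* κ) := RingHom.ext fun _ => rfl
  have hI : I.map (map (σ := σ) (s : κ →+* κ)) = I.map (e : MvPowerSeries σ κ →+* MvPowerSeries σ κ) := by rw [he]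
  let j : (MvPowerSeries σ κ ⧸ I) ≃+* (MvPowerSeries σ κ ⧸ I.map (map (σ := σ) (s : κ →+* κ))) :=
    Ideal.quotientEquiv I _ e hI
  symm
  refine Algebra.finrank_eq_of_equiv_equiv s j (RingHom.ext fun l => ?_)
  change algebraMap κ _ (s l) = j (algebraMap κ _ l)
  rw [← Ideal.Quotient.mk_algebraMap, ← Ideal.Quotient.mk_algebraMap]
  change Ideal.Quotient.mk _ (algebraMap κ (MvPowerSeries σ κ) (s l)) =
    Ideal.quotientEquiv I _ e hI (Ideal.Quotient.mk I (algebraMap κ (MvPowerSeries σ κ) l))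
  rw [Ideal.quotientEquiv_mk, MvPowerSeries.algebraMap_apply, MvPowerSeries.algebraMap_apply, Algebra.algebraMap_self,
    RingHom.id_apply, RingHom.id_apply]
  change _ = Ideal.Quotient.mk _ (map (σ := σ) (s : κ →+* κ) (C l))
  rw [map_C, RingEquiv.coe_toRingHom]

/-! ## Arbitrary ring automorphisms over a perfect field -/

/-- [OURS · L1 W4.6 — DICTIONARY, the Tjurina NUMBER is intrinsic under RING automorphisms; NOT a statement of the
manuscript] Over a perfect field `κ` of characteristic `p`, for every ring automorphism `θ` of `κ⟦z,u₁,…,uₙ⟧` and unit `w`: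
`dim_κ κ⟦X⟧/T(w·θF) = dim_κ κ⟦X⟧/T(F)`. [folklore] -/
theorem finrank_tjurina_eq_of_ringEquiv_option (p : ℕ) [Fact p.Prime] [CharP κ p] [PerfectRing κ p] {n : ℕ}
    (θ : MvPowerSeries (Option (Fin n)) κ ≃+* MvPowerSeries (Option (Fin n)) κ)
    (F w : MvPowerSeries (Option (Fin n)) κ) (hw : IsUnit w) :
    Module.finrank κ (MvPowerSeries (Option (Fin n)) κ ⧸
        (Ideal.span {w * θ F} ⊔ Ideal.span (Set.range fun j : Option (Fin n) => pd j (w * θ F)))) =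
      Module.finrank κ (MvPowerSeries (Option (Fin n)) κ ⧸
        (Ideal.span {F} ⊔ Ideal.span (Set.range fun i : Option (Fin n) => pd i F))) := by
  obtain ⟨s, θ', hθ⟩ := exists_algEquiv_forall_eq p θ
  rw [hθ F, finrank_tjurina_eq_of_algEquiv_option θ' _ w hw, tjurina_map_eq_map, finrank_quotient_map_eq]

/-! ## The Tjurina number does not depend on the presentation -/

/-- [OURS · L1 W4.6 — DICTIONARY, the Tjurina number is independent of the presentation; NOT a statement of the manuscript]
Two formal presentations `E₀(f₀) = w·(z^p − ser c₀)`, `E₀′(f₀′) = w′·(z^p − ser c₀′)` (ring isomorphisms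
`E₀, E₀′ : S ≃+* K⟦z,u⟧`, units `w, w′`) of the same principal ideal `(f₀) = (f₀′)` of a local ring `R` over a perfect
field `K` of characteristic `p` have Tjurina algebras of the same `K`-dimension. [folklore] -/
theorem finrank_tjurina_eq_of_span_eq {p : ℕ} [Fact p.Prime] {K : Type} [Field K] [CharP K p] [PerfectRing K p] {n : ℕ}
    {R S : Type} [CommRing R] [IsLocalRing R] [CommRing S] [Algebra R S]
    (E₀ E₀' : S ≃+* MvPowerSeries (Option (Fin n)) K) (f₀ f₀' : R) (c₀ c₀' : (Fin n → ℕ) → K)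
    (w w' : MvPowerSeries (Option (Fin n)) K) (hJ : Ideal.span {f₀} = Ideal.span {f₀'})
    (hw : IsUnit w) (hw' : IsUnit w')
    (hf₀ : E₀ (algebraMap R S f₀) =
      w * ((X none : MvPowerSeries (Option (Fin n)) K) ^ p -
        rename (some : Fin n → Option (Fin n)) (ser p n K c₀)))
    (hf₀' : E₀' (algebraMap R S f₀') =
      w' * ((X none : MvPowerSeries (Option (Fin n)) K) ^ p -
        rename (some : Fin n → Option (Fin n)) (ser p n K c₀'))) :
    Module.finrank K (MvPowerSeries (Option (Fin n)) K ⧸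
        (Ideal.span {(X none : MvPowerSeries (Option (Fin n)) K) ^ p -
            rename (some : Fin n → Option (Fin n)) (ser p n K c₀')} ⊔
          Ideal.span (Set.range fun j : Option (Fin n) =>
            pd j ((X none : MvPowerSeries (Option (Fin n)) K) ^ p -
              rename (some : Fin n → Option (Fin n)) (ser p n K c₀'))))) =
      Module.finrank K (MvPowerSeries (Option (Fin n)) K ⧸
        (Ideal.span {(X none : MvPowerSeries (Option (Fin n)) K) ^ p -
            rename (some : Fin n → Option (Fin n)) (ser p n K c₀)} ⊔
          Ideal.span (Set.range fun j : Option (Fin n) =>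
            pd j ((X none : MvPowerSeries (Option (Fin n)) K) ^ p -
              rename (some : Fin n → Option (Fin n)) (ser p n K c₀))))) := by
  have hp : p ≠ 0 := (Fact.out : p.Prime).ne_zero
  -- the two generators differ by factors `a`, `b`
  have ha' : f₀' ∈ Ideal.span {f₀} := by
    rw [hJ]
    exact Ideal.mem_span_singleton_self f₀'
  have hb' : f₀ ∈ Ideal.span {f₀'} := by
    rw [← hJ]
    exact Ideal.mem_span_singleton_self f₀
  obtain ⟨a, ha⟩ := Ideal.mem_span_singleton'.mp ha'
  obtain ⟨b, hb⟩ := Ideal.mem_span_singleton'.mp hb'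
  -- the atom is non-zero, hence so is `f₀` in `S`
  have hF : (X none : MvPowerSeries (Option (Fin n)) K) ^ p -
      rename (some : Fin n → Option (Fin n)) (ser p n K c₀) ≠ 0 := fun h =>
    atom_not_mem_maximalIdeal_pow_succ hp (ser p n K c₀) (by rw [h]; exact zero_mem _)
  have hf₀ne : algebraMap R S f₀ ≠ 0 := by
    intro h
    apply hF
    have h1 := hf₀
    rw [h, map_zero] at h1
    exact (hw.mul_right_eq_zero.mp h1.symm)
  -- `a` is a unit of the local ring `R`
  have haU : IsUnit a := by
    by_contra hna
    have hba : b * a ∈ nonunits R := fun hu => hna (isUnit_of_mul_isUnit_right hu)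
    have hu : IsUnit (1 - b * a) := IsLocalRing.isUnit_one_sub_self_of_mem_nonunits (b * a) hba
    have h1 : (1 - b * a) * f₀ = 0 := by
      rw [sub_mul, one_mul, mul_assoc, ha, hb, sub_self]
    exact hf₀ne (by rw [hu.mul_right_eq_zero.mp h1, map_zero])
  -- the ring automorphism `θ = E₀′ ∘ E₀⁻¹` and the unit `W`
  let θ : MvPowerSeries (Option (Fin n)) K ≃+* MvPowerSeries (Option (Fin n)) K := E₀.symm.trans E₀'
  have hθ : ∀ x : S, θ (E₀ x) = E₀' x := fun x => by
    change E₀' (E₀.symm (E₀ x)) = E₀' x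
    rw [RingEquiv.symm_apply_apply]
  obtain ⟨u', hu'⟩ := hw'
  have hW : IsUnit ((↑u'⁻¹ : MvPowerSeries (Option (Fin n)) K) * E₀' (algebraMap R S a) * θ w) :=
    ((Units.isUnit u'⁻¹).mul ((haU.map (algebraMap R S)).map E₀')).mul (hw.map θ)
  have key : (X none : MvPowerSeries (Option (Fin n)) K) ^ p -
      rename (some : Fin n → Option (Fin n)) (ser p n K c₀') =
        ((↑u'⁻¹ : MvPowerSeries (Option (Fin n)) K) * E₀' (algebraMap R S a) * θ w) *
          θ ((X none : MvPowerSeries (Option (Fin n)) K) ^ p -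
            rename (some : Fin n → Option (Fin n)) (ser p n K c₀)) := by
    have h1 : E₀' (algebraMap R S f₀') = E₀' (algebraMap R S a) * (θ w *
        θ ((X none : MvPowerSeries (Option (Fin n)) K) ^ p -
          rename (some : Fin n → Option (Fin n)) (ser p n K c₀))) := by
      rw [← map_mul θ, ← hf₀, hθ, ← map_mul, ← map_mul, ha]
    rw [hf₀', ← hu'] at h1
    have h2 := congrArg (fun x => (↑u'⁻¹ : MvPowerSeries (Option (Fin n)) K) * x) h1
    simp only [← mul_assoc, Units.inv_mul, one_mul] at h2
    rw [h2]
  rw [key]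
  exact finrank_tjurina_eq_of_ringEquiv_option p θ _ _ hW

end CampaignW46.AtomGerm

end Summit.ResolutionOfSingularities.ResolutionOfSingularities.Theorems

end
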